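import Summits.ResolutionOfSingularities.ResolutionOfSingularities.Theorems.PurelyInseparableDim4E2OfCJSLocalize
import Summits.ResolutionOfSingularities.ResolutionOfSingularities.Theorems.PurelyInseparableDim4E2NearPresentation
import HarnessLib

/-!
# F4-I(3,3) from CJS — the row holder's STATUS file: adapters of the landed sub-rows and the current
# conditional assembly (cell `res-dim4-pi`, WORD #52 (c) / #57 / #59 (a); APPENDED at every row landing)

[OURS · counted 0 · AI work weaker than expert review.]  Cell `res-dim4-pi` (D-0157 DOOR 2), seat `res-dim4-p-2`
g2 (holder of the E2 transfer row and its sub-rows, `…E2OfCJSRows` p663940); K → res-dim4-p-9 g2.  NOTHING here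
proves the open rows, `NoIsolatedTrap 3 3`, or resolution of singularities in dimension ≥ 4 / characteristic `p`.

STATE OF RECORD (2026-08-28T20:4xZ).  F4-I(3,3) = `NoIsolatedTrap 3 3` ⟸ [CJS LNM 2270 Thm 6.40, unit-wise
localised isolated form — NAMED FACT `KeyTheorem640_char_localized_isolated` (F-111)] ∧ the OURS rows:
* (N) `NearRow` — **DISCHARGED** by res-dim4-p-1 g2 (`E2Near.nearRow_unfolded`, `…E2NearPresentation`,
  p664524); adapter `nearRow` below;
* (X) `SettingRow` — **DISCHARGED** (`settingRow`, `…E2OfCJSSetting`, p664844);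
* (M) `ModelRow` = (M-a) **DISCHARGED** (`globalModel_of_coneTwoChain`, `…E2OfCJSModel`, p665319) ∧ (M-b)
  `LocalizationRow` OPEN (res-dim4-p-7 g2; atom (M-c) res-dim4-p-5 g2) — `modelRow_of_localizationRow`
  (`…E2OfCJSLocalize`, p665567);
* (E) `DirectrixRow` OPEN (res-dim4-p-1 g2 ⊃ res-dim4-p-3 g2 / res-dim4-p-5 g2 identities);
* (I) `IsolationRow` OPEN (res-dim4-p-11 g2; (I1) `…SymbolicPower` p665211 ✓, (I2) glue in progress).
Hence **`noIsolatedTrap_three_three_of_CJS_status : KeyTheorem640_char_localized_isolated → LocalizationRow →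
DirectrixRow → IsolationRow → NoIsolatedTrap 3 3`** — three OURS rows and one printed theorem away.
bears_on: LADDER-RESOLUTION:D157-DOOR2 (res-dim4-pi · F4-I(3,3) · CJS dictionary · status).  Supports
stmt-ResolutionOfSingularities-16155 (helper).
-/

set_option linter.dupNamespace false -- mandated namespace of this single-conjunct summit

noncomputable section

open Literature.AlgebraicGeometry.CossartJannsenSaito2020

namespace Summit.ResolutionOfSingularities.ResolutionOfSingularities.Theorems.PIDim4

namespace E2OfCJS

/-- **ROW (N) `NearRow` BY NAME** — res-dim4-p-1 g2's `E2Near.nearRow_unfolded` (p664524) is the literal body of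
the row (`PresentedBy` / `HypStalk` δ-unfolded): two points presented over the same perfect field of
characteristic `3` by residual polynomials of order `3` have the same Hilbert–Samuel function at every level.
[OURS · adapter] [folklore] -/
theorem nearRow : NearRow := E2Near.nearRow_unfolded

/-- **F4-I(3,3) FROM CJS Thm. 6.40 — STATUS 20:4xZ**: with (N), (X) and (M-a) discharged in the tree, the
crux `NoIsolatedTrap 3 3` follows from the named fact `KeyTheorem640_char_localized_isolated` and the three
OPEN OURS rows (M-b) `LocalizationRow`, (E) `DirectrixRow`, (I) `IsolationRow`. [OURS · conditional assembly]
[cite: CossartJannsenSaito2020, Thm. 6.40] -/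
theorem noIsolatedTrap_three_three_of_CJS_status (hK640 : KeyTheorem640_char_localized_isolated.{0})
    (hMb : LocalizationRow) (hE : DirectrixRow) (hI : IsolationRow) : NoIsolatedTrap 3 3 :=
  noIsolatedTrap_three_three_of_CJS_rows' hK640 hMb nearRow hE hI

end E2OfCJS

end Summit.ResolutionOfSingularities.ResolutionOfSingularities.Theorems.PIDim4

end
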